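import Summits.QuantumAdvantage.AdviceFreeQNC0.HiddenCoinsReduction
import Summits.QuantumAdvantage.AdviceFreeQNC0.WalkHardFLinForms
import HarnessLib

/-!
# Rung R11″ `WalkHardFLinFormsSqrt p`: strategies reading the input through `K ≤ √(κ_p·n)` linear forms mod `p`, with
# ARBITRARY tables, lose the u-walk game (every prime `p ≠ 3`; planner qa-qnc0-p2 g20, ROUND-20 (p2) §3; ask P2-20a; item stmt-QuantumAdvantage-27290)

Planner qa-qnc0-p2 g20's `line20/Sketch20.lean` defs `WalkHardFLinFormsSqrt` / `LinFormsSqrtGlue` VERBATIM.  The tree theorem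
`walkHardFLinForms` (R11', `WalkHardFLinForms.lean`) allows `K ≤ (log₂ n)^C` forms because its junta input `walkHardFJunta`
needs a polylog junta; with the hidden-coins bound `hiddenCoinsFour` (J_4, `HiddenCoinsReduction.lean`: EVERY common junta
`|J| ≤ n − 4` gives `θ_J = 3/4`) the same regularise–expand argument (`LinForms.card_win_le` + `LinForms.exists_regular_span`,
junta `|J| ≤ K·w`, `w = K·m + m₀` with `ρ^m < 1/p`, `3√6·ρ^{m₀} < 1/8`, `ρ = cos(π/3p)`) closes as soon as `K·w + 4 ≤ n`, i.e. for
`K² ≤ κ·n` with `κ = 1/(2(m + m₀ + 1))`, `n ≥ 8`: `#win ≤ (3/4 + 1/8)·2ⁿ`.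
Main results: `linFormsSqrtGlue : LinFormsSqrtGlue p` (every prime), **`walkHardFLinFormsSqrt (p) (hp3 : p ≠ 3) :
WalkHardFLinFormsSqrt p`** (`θ = 7/8`; item stmt-QuantumAdvantage-27290 `LinFormsSqrtOdd` is the case `p ≥ 5`).
This is the LAST rung the regularise–expand method reaches (`K·w(K) ≤ n`, `w ≍ p²K ln p`; ROUND-20 §3).
Appended (qn-prover-3 g13, optional item of P2-20a): **R11°** `card_win_le_of_minDistance` / `walkHardFLinFormsCode` — with the EMPTY
junta, `K ≤ κ·n` forms whose span is a code of minimum distance `≥ n/2` are harmless (`θ = 7/8`): the (W2) cell union bites only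
through light words of the span.
WHAT THIS IS NOT: the rank-`n` dense residual R5 `WalkHardFLinSel` / cruxes 23109, 23029 (the `p^K` cell-union wall (W2)) is
untouched; false for `p = 3`; rung F-Q2-odd instrument; separation NOT moved.
-/

noncomputable section

namespace Summit.QuantumAdvantage.AdviceFreeQNC0

open Finset

/-- **Rung R11″ (rank-√n linear forms, arbitrary tables).** For some `θ < 1`, `κ > 0` and all large `n`: a strategy
reading `u` only through `K` linear forms mod `p` with `K² ≤ κ·n`, with arbitrary tables per cut, wins on ≤ θ·2ⁿ inputs. -/
def WalkHardFLinFormsSqrt (p : ℕ) [Fact p.Prime] : Prop :=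
  ∃ θ : ℝ, θ < 1 ∧ ∃ κ : ℝ, 0 < κ ∧ ∃ n₀ : ℕ, ∀ n ≥ n₀, ∀ c K : ℕ, (K : ℝ) ^ 2 ≤ κ * n →
    ∀ lam : Fin K → Fin n → ZMod p, ∀ tab : Fin (n + 1) → (Fin K → ZMod p) → Bool,
      ((univ.filter fun u : Fin n → Bool =>
          ringWinU c (fun g v => tab g (fun j => ∑ i, if v i then lam j i else 0)) u = true).card : ℝ) ≤
        θ * (2 : ℝ) ^ n

/-- Glue for R11″ (support, size S/M): `card_win_le` with the junta `J` of `exists_regular_span` (|J| ≤ K·w),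
`w := ⌈(K ln p + λ)/(−ln cos(π/3p))⌉`, and `HiddenCoinsFour` as the junta bound once `K·w + 4 ≤ n`. -/
def LinFormsSqrtGlue (p : ℕ) [Fact p.Prime] : Prop := p ≠ 3 → HiddenCoinsFour → WalkHardFLinFormsSqrt p

open LinForms in
/-- **R11″ glue — PROVED**: `θ = 7/8`, `κ = 1/(2(m + m₀ + 1))` with `ρ^m < 1/p`, `3√6·ρ^{m₀} < 1/8` (`ρ = cos(π/3p)`),
`w = K·m + m₀`, `n₀ = 8`. -/
theorem linFormsSqrtGlue (p : ℕ) [Fact p.Prime] : LinFormsSqrtGlue p := by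
  intro hp3 hJ4
  classical
  have hp2 : 2 ≤ p := (Fact.out : p.Prime).two_le
  have hpR : (2 : ℝ) ≤ p := by exact_mod_cast hp2
  set ρ : ℝ := Real.cos (Real.pi / (3 * p)) with hρ
  have hρ0 : 0 ≤ ρ := by
    apply Real.cos_nonneg_of_neg_pi_div_two_le_of_le
    · have : 0 ≤ Real.pi / (3 * p) := by positivity
      linarith [Real.pi_pos]
    · rw [div_le_div_iff₀ (by positivity) (by norm_num)]
      nlinarith [Real.pi_pos]
  have hρ1 : ρ < 1 := by
    rw [hρ, ← Real.cos_zero]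
    apply Real.cos_lt_cos_of_nonneg_of_le_pi (le_refl 0)
    · rw [div_le_iff₀ (by positivity)]; nlinarith [Real.pi_pos]
    · positivity
  -- `ρ^m < 1/p`, `ρ^{m₀} < (1/8)/(3√6)`
  obtain ⟨m, hm⟩ := exists_pow_lt_of_lt_one (show (0 : ℝ) < 1 / p by positivity) hρ1
  have h6 : (0 : ℝ) < 3 * Real.sqrt 6 := by positivity
  obtain ⟨m₀, hm₀⟩ := exists_pow_lt_of_lt_one (show (0 : ℝ) < 1 / 8 / (3 * Real.sqrt 6) by positivity) hρ1
  refine ⟨7 / 8, by norm_num, 1 / (2 * ((m : ℝ) + m₀ + 1)), by positivity, 8, fun n hn c K hK lam tab => ?_⟩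
  -- the junta set
  set w := K * m + m₀ with hw
  obtain ⟨J, hJcard, hreg⟩ := exists_regular_span lam w
  have hJ4n : J.card + 4 ≤ n := by
    have hKK : (K : ℝ) ≤ (K : ℝ) ^ 2 := by
      rcases Nat.eq_zero_or_pos K with hK0 | hK0
      · simp [hK0]
      · have : (1 : ℝ) ≤ K := by exact_mod_cast hK0
        nlinarith
    have hmm : (0 : ℝ) ≤ (m : ℝ) + m₀ := by positivity
    have hm0' : (0 : ℝ) ≤ (m₀ : ℝ) := by positivity
    have h1 : (J.card : ℝ) ≤ (K : ℝ) ^ 2 * ((m : ℝ) + m₀) := by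
      have h0 : (J.card : ℝ) ≤ (K : ℝ) * ((K : ℝ) * m + m₀) := by exact_mod_cast hJcard
      nlinarith [mul_le_mul_of_nonneg_right hKK hm0']
    have h2 : (K : ℝ) ^ 2 * ((m : ℝ) + m₀) ≤ (n : ℝ) / 2 := by
      have h3 := mul_le_mul_of_nonneg_right hK hmm
      have hA : 0 ≤ 1 / (2 * ((m : ℝ) + m₀ + 1)) * n := by positivity
      have h4a : 1 / (2 * ((m : ℝ) + m₀ + 1)) * n * ((m : ℝ) + m₀) ≤
          1 / (2 * ((m : ℝ) + m₀ + 1)) * n * ((m : ℝ) + m₀ + 1) :=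
        mul_le_mul_of_nonneg_left (by linarith) hA
      have h4b : 1 / (2 * ((m : ℝ) + m₀ + 1)) * n * ((m : ℝ) + m₀ + 1) = (n : ℝ) / 2 := by
        rw [div_mul_eq_mul_div, div_mul_eq_mul_div, one_mul, div_eq_div_iff (by positivity) (by norm_num)]
        ring
      linarith
    have hn8 : (8 : ℝ) ≤ n := by exact_mod_cast hn
    have : (J.card : ℝ) + 4 ≤ n := by linarith
    exact_mod_cast this
  have hJbound : ∀ y : Fin (n + 1) → (Fin n → Bool) → Bool,
      (∀ g, ∀ u v : Fin n → Bool, (∀ i ∈ J, u i = v i) → y g u = y g v) →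
      ((univ.filter fun u : Fin n → Bool => ringWinU c y u = true).card : ℝ) ≤ 3 / 4 * (2 : ℝ) ^ n :=
    fun y hy => hJ4 n c J hJ4n y hy
  have hq := card_win_le hp3 c lam tab J hreg hJbound
  -- the error term is at most `(1/8)·2ⁿ`
  have hρm : ρ ^ m ≤ 1 / p := hm.le
  have hpow : (p : ℝ) ^ K * ρ ^ w ≤ ρ ^ m₀ := by
    rw [hw, pow_add, mul_comm K m, pow_mul]
    have h1 : (ρ ^ m) ^ K ≤ (1 / (p : ℝ)) ^ K := pow_le_pow_left₀ (by positivity) hρm K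
    have h2 : (p : ℝ) ^ K * (1 / (p : ℝ)) ^ K = 1 := by
      rw [← mul_pow, mul_one_div_cancel (by positivity), one_pow]
    calc (p : ℝ) ^ K * ((ρ ^ m) ^ K * ρ ^ m₀) = ((p : ℝ) ^ K * (ρ ^ m) ^ K) * ρ ^ m₀ := by ring
      _ ≤ ((p : ℝ) ^ K * (1 / (p : ℝ)) ^ K) * ρ ^ m₀ := by
          apply mul_le_mul_of_nonneg_right _ (by positivity)
          exact mul_le_mul_of_nonneg_left h1 (by positivity)
      _ = ρ ^ m₀ := by rw [h2, one_mul]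
  have herr : 3 * Real.sqrt 6 * (p : ℝ) ^ K * ρ ^ w * (2 : ℝ) ^ n ≤ 1 / 8 * (2 : ℝ) ^ n := by
    have h2n : (0 : ℝ) ≤ (2 : ℝ) ^ n := by positivity
    have h1 : 3 * Real.sqrt 6 * ((p : ℝ) ^ K * ρ ^ w) ≤ 3 * Real.sqrt 6 * ρ ^ m₀ :=
      mul_le_mul_of_nonneg_left hpow h6.le
    have h3 : 3 * Real.sqrt 6 * ρ ^ m₀ ≤ 1 / 8 := by
      have := hm₀.le
      rw [le_div_iff₀ h6] at this
      linarith
    nlinarith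
  linarith


open LinForms in
/-- **Rung R11″ — PROVED for every prime `p ≠ 3`** (`θ = 7/8`): strategies reading the input only through `K` linear forms
mod `p`, `K² ≤ κ_p·n`, arbitrary tables, win α's u-walk game on at most `θ·2ⁿ` inputs. -/
theorem walkHardFLinFormsSqrt (p : ℕ) [Fact p.Prime] (hp3 : p ≠ 3) : WalkHardFLinFormsSqrt p :=
  linFormsSqrtGlue p hp3 hiddenCoinsFour

/-! ### R11° — codes of linear distance: linearly many forms are harmless when their span has linear distance
(ROUND-20 (p2) §1, the (W2) bullet; optional item of ask P2-20a; qn-prover-3 g13) -/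

open LinForms in
/-- **R11° (quantitative)**: for `n ≥ 4`, a strategy reading `K` linear forms mod `p` whose span has minimum distance `≥ w`
(every non-zero combination of the forms has at least `w` non-zero coefficients), with ARBITRARY tables, wins α's u-walk game on
at most `(3/4)·2ⁿ + 3√6·p^K·cos(π/3p)^w·2ⁿ` inputs — `LinForms.card_win_le` with the EMPTY junta set (regularity = minimum
distance) and J_4 `hiddenCoinsFour` as the bound for the constant strategies. -/
theorem card_win_le_of_minDistance (p : ℕ) [Fact p.Prime] (hp3 : p ≠ 3) {n K : ℕ} (hn : 4 ≤ n) (c : ℕ)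
    (lam : Fin K → Fin n → ZMod p) (tab : Fin (n + 1) → (Fin K → ZMod p) → Bool) {w : ℕ}
    (hdist : ∀ β ∈ Submodule.span (ZMod p) (Set.range lam), β ≠ 0 → w ≤ (univ.filter fun i => β i ≠ 0).card) :
    ((univ.filter fun u : Fin n → Bool =>
        ringWinU c (fun g v => tab g (fun j => ∑ i, if v i then lam j i else 0)) u = true).card : ℝ) ≤
      3 / 4 * (2 : ℝ) ^ n + 3 * Real.sqrt 6 * (p : ℝ) ^ K * Real.cos (Real.pi / (3 * p)) ^ w * (2 : ℝ) ^ n := by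
  classical
  have hreg : Regular (Submodule.span (ZMod p) (Set.range lam)) w ∅ := by
    intro β hβ hlt
    rw [mem_suppIn]
    by_contra hne
    push Not at hne
    obtain ⟨i, -, hi⟩ := hne
    have hβ0 : β ≠ 0 := fun h => hi (by rw [h]; rfl)
    have e : outSupp (F := ZMod p) ∅ β = univ.filter fun i => β i ≠ 0 := by
      unfold outSupp
      exact filter_congr fun i _ => by simp
    rw [e] at hlt
    have := hdist β hβ hβ0
    omega
  have hJ : ∀ y : Fin (n + 1) → (Fin n → Bool) → Bool,
      (∀ g, ∀ u v : Fin n → Bool, (∀ i ∈ (∅ : Finset (Fin n)), u i = v i) → y g u = y g v) →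
      ((univ.filter fun u : Fin n → Bool => ringWinU c y u = true).card : ℝ) ≤ 3 / 4 * (2 : ℝ) ^ n :=
    fun y hy => hiddenCoinsFour n c ∅ (by rw [Finset.card_empty]; omega) y hy
  exact card_win_le hp3 c lam tab ∅ hreg hJ

open LinForms in
/-- **R11° — PROVED for every prime `p ≠ 3`** (`θ = 7/8`): there is `κ > 0` such that for all large `n`, a strategy reading
`K ≤ κ·n` linear forms mod `p` whose span is a code of minimum distance `≥ n/2`, with arbitrary tables, wins on at most `θ·2ⁿ`
inputs.  LINEARLY many forms are not the obstruction — the `p^K` cell union (W2) only bites when the span contains light words. -/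
theorem walkHardFLinFormsCode (p : ℕ) [Fact p.Prime] (hp3 : p ≠ 3) :
    ∃ θ : ℝ, θ < 1 ∧ ∃ κ : ℝ, 0 < κ ∧ ∃ n₀ : ℕ, ∀ n ≥ n₀, ∀ c K : ℕ, (K : ℝ) ≤ κ * n →
      ∀ lam : Fin K → Fin n → ZMod p, ∀ tab : Fin (n + 1) → (Fin K → ZMod p) → Bool,
        (∀ β ∈ Submodule.span (ZMod p) (Set.range lam), β ≠ 0 →
          (n : ℝ) / 2 ≤ ((univ.filter fun i => β i ≠ 0).card : ℝ)) →
        ((univ.filter fun u : Fin n → Bool =>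
            ringWinU c (fun g v => tab g (fun j => ∑ i, if v i then lam j i else 0)) u = true).card : ℝ) ≤
          θ * (2 : ℝ) ^ n := by
  classical
  have hp2 : 2 ≤ p := (Fact.out : p.Prime).two_le
  have hpR : (2 : ℝ) ≤ p := by exact_mod_cast hp2
  set ρ : ℝ := Real.cos (Real.pi / (3 * p)) with hρ
  have hρ0 : 0 ≤ ρ := by
    apply Real.cos_nonneg_of_neg_pi_div_two_le_of_le
    · have : 0 ≤ Real.pi / (3 * p) := by positivity
      linarith [Real.pi_pos]
    · rw [div_le_div_iff₀ (by positivity) (by norm_num)]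
      nlinarith [Real.pi_pos]
  have hρ1 : ρ < 1 := by
    rw [hρ, ← Real.cos_zero]
    apply Real.cos_lt_cos_of_nonneg_of_le_pi (le_refl 0)
    · rw [div_le_iff₀ (by positivity)]; nlinarith [Real.pi_pos]
    · positivity
  obtain ⟨m, hm⟩ := exists_pow_lt_of_lt_one (show (0 : ℝ) < 1 / p by positivity) hρ1
  have h6 : (0 : ℝ) < 3 * Real.sqrt 6 := by positivity
  obtain ⟨m₀, hm₀⟩ := exists_pow_lt_of_lt_one (show (0 : ℝ) < 1 / 8 / (3 * Real.sqrt 6) by positivity) hρ1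
  refine ⟨7 / 8, by norm_num, 1 / (4 * ((m : ℝ) + 1)), by positivity, 4 * m₀ + 4, fun n hn c K hK lam tab hdist => ?_⟩
  -- the distance hypothesis in natural numbers: `w := K·m + m₀ ≤ n/2 ≤ distance`
  set w := K * m + m₀ with hw
  have hKm : (K : ℝ) * m ≤ (n : ℝ) / 4 := by
    have hm1 : (0 : ℝ) ≤ (m : ℝ) := by positivity
    have h1 : (K : ℝ) * m ≤ 1 / (4 * ((m : ℝ) + 1)) * n * m := mul_le_mul_of_nonneg_right hK hm1
    have h2 : 1 / (4 * ((m : ℝ) + 1)) * n * m ≤ 1 / (4 * ((m : ℝ) + 1)) * n * (m + 1) :=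
      mul_le_mul_of_nonneg_left (by linarith) (by positivity)
    have h3 : 1 / (4 * ((m : ℝ) + 1)) * n * (m + 1) = (n : ℝ) / 4 := by
      rw [div_mul_eq_mul_div, div_mul_eq_mul_div, one_mul, div_eq_div_iff (by positivity) (by norm_num)]
      ring
    linarith
  have hm₀n : (m₀ : ℝ) ≤ (n : ℝ) / 4 := by
    have : ((4 * m₀ + 4 : ℕ) : ℝ) ≤ n := by exact_mod_cast hn
    push_cast at this
    linarith
  have hwn : (w : ℝ) ≤ (n : ℝ) / 2 := by rw [hw]; push_cast; linarith
  have hdist' : ∀ β ∈ Submodule.span (ZMod p) (Set.range lam), β ≠ 0 → w ≤ (univ.filter fun i => β i ≠ 0).card := by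
    intro β hβ hβ0
    have := (hwn.trans (hdist β hβ hβ0))
    exact_mod_cast this
  have hn4 : 4 ≤ n := le_trans (by omega) hn
  have hq := card_win_le_of_minDistance p hp3 hn4 c lam tab hdist'
  -- the error term is at most `(1/8)·2ⁿ`
  have hρm : ρ ^ m ≤ 1 / p := hm.le
  have hpow : (p : ℝ) ^ K * ρ ^ w ≤ ρ ^ m₀ := by
    rw [hw, pow_add, mul_comm K m, pow_mul]
    have h1 : (ρ ^ m) ^ K ≤ (1 / (p : ℝ)) ^ K := pow_le_pow_left₀ (by positivity) hρm K
    have h2 : (p : ℝ) ^ K * (1 / (p : ℝ)) ^ K = 1 := by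
      rw [← mul_pow, mul_one_div_cancel (by positivity), one_pow]
    calc (p : ℝ) ^ K * ((ρ ^ m) ^ K * ρ ^ m₀) = ((p : ℝ) ^ K * (ρ ^ m) ^ K) * ρ ^ m₀ := by ring
      _ ≤ ((p : ℝ) ^ K * (1 / (p : ℝ)) ^ K) * ρ ^ m₀ := by
          apply mul_le_mul_of_nonneg_right _ (by positivity)
          exact mul_le_mul_of_nonneg_left h1 (by positivity)
      _ = ρ ^ m₀ := by rw [h2, one_mul]
  have herr : 3 * Real.sqrt 6 * (p : ℝ) ^ K * ρ ^ w * (2 : ℝ) ^ n ≤ 1 / 8 * (2 : ℝ) ^ n := by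
    have h2n : (0 : ℝ) ≤ (2 : ℝ) ^ n := by positivity
    have h1 : 3 * Real.sqrt 6 * ((p : ℝ) ^ K * ρ ^ w) ≤ 3 * Real.sqrt 6 * ρ ^ m₀ :=
      mul_le_mul_of_nonneg_left hpow h6.le
    have h3 : 3 * Real.sqrt 6 * ρ ^ m₀ ≤ 1 / 8 := by
      have := hm₀.le
      rw [le_div_iff₀ h6] at this
      linarith
    nlinarith
  linarith

end Summit.QuantumAdvantage.AdviceFreeQNC0

end
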